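/-
Copyright (c) 2026 the pub-hodgecm-mathlib formalisation cell (harness21).  Prover seat hodgecm-mathlib-K2-defs1 (g4), Track B ∕ K2-LIT,
h413 = `stmt-HodgeConjecture-24833`, line `K2_E1_TraceFormulaBeta`, page «EIS-WHITTAKER-2», deal W2-fin of the dealer K2E1-plan (g4) 2026-09-04T07:06:03Z ∕ 07:13:06Z:
the FINITE-PLACE Whittaker integral of the rank-one flat section, `I(ξ, z) = ∫_F max(1, ‖t‖)^{−2z} ψ(tξ) dμ(t)`, is a polynomial in `q^{−z}`.
-/
import Summits.HodgeConjecture.HodgeConjecture.Theorems.K2E1IntertwiningLocalFactorU2   -- ★ p858040 (K2E2-p12 (g4)): `integrable_and_integral_max_one_normAbs_cpow_two_mul` (the `ξ = 0` currency); brings ★ `K2LiuGKRankOneIntegral`, ★ Tate local files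
import HarnessLib

/-!
# h413 ∕ Track B «K2-LIT», «EIS-WHITTAKER-2» W2-fin — `K2E1FiniteWhittakerPolynomial`: over a non-archimedean local field `F`,
# `∫_F max(1,‖t‖_F)^{−2z} ψ(tξ) dμ(t) = μ(𝒪)·(1 − q^{−2z})·Σ_{k=0}^{n} q^{k(1−2z)}` (`n = ord ξ − cond ψ ≥ 0`), and `= 0` if `n < 0`

Cell `pub/hodgecm-mathlib`, crux H413 = `stmt-HodgeConjecture-24833`, route `HCCMUnconditional`; dealer K2E1-plan (g4), spec 07:06:03Z (a)–(d), deal 07:13:06Z.  THEOREMS ONLY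
(no `def`, no `instance`, no `notation`, no named-fact hypothesis, no `sorry`); lane `--kind proof --supports stmt-HodgeConjecture-24833 --as helper` (count-neutral).
Currency: `F` with `[IsNonarchimedeanLocalField F]`, `q = residueFieldCard F`, `‖·‖ = normAbs F`, balls `𝔭^n = primePowBall F n`, `ψ : AddChar F Circle` continuous of
conductor exponent `m` (`ψ.HasConductorExp m`: trivial on `𝔭^m`, not on `𝔭^{m−1}`), weight `max(1,‖t‖)^{−2z}` in ★ p858040's bytes
`(((max 1 ((normAbs F t : ℝ≥0) : ℝ) : ℝ) : ℂ) ^ (-(2 * z)))`, character `((ψ (t * ξ) : Circle) : ℂ)` (Tate's `ψ(xy)` order, ★ `setIntegral_primePowBall_addChar_mul`).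

THE COMPUTATION (Tate 1950 §2.5 ∕ Casselman 1980 §3; the dealer's (a)–(d)).  Write `c = q^{−2z}`, `J_k = ∫_{𝔭^{−k}} ψ(tξ) dμ = 𝟙[ξ ∈ 𝔭^{m+k}]·q^k μ(𝒪)` (★ orthogonality).  On the
sphere `𝔭^{−(k+1)} ∖ 𝔭^{−k}` the weight is the constant `c^{k+1}` (★ `coe_normAbs_of_mem_outerShell`), so (a) the BALL integrals satisfy the finite shell recursion
`∫_{𝔭^{−(k+1)}} = ∫_{𝔭^{−k}} + c^{k+1}(J_{k+1} − J_k)`, i.e. `∫_{𝔭^{−K}} max(1,‖t‖)^{−2z}ψ(tξ) = J_0 + Σ_{k<K} c^{k+1}(J_{k+1} − J_k)` for EVERY `z` (no convergence issue on a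
compact ball); (b) is ★; (c) if `ξ ∈ 𝔭^{m+n} ∖ 𝔭^{m+n+1}` (`n = ord ξ − m ≥ 0`) the `J_k` vanish for `k > n` and the ball integrals are CONSTANT in `K > n`, equal to
`μ(𝒪)·(1 − c)·Σ_{k=0}^{n} (cq)^k` — a polynomial in `q^{−z}` (entire in `z`, `‖·‖ ≤ 2(n+1)μ(𝒪)` on `Re z ≥ ½`); if `ξ ∉ 𝔭^m` every `J_k = 0` and every ball integral
vanishes; for `Re z > ½` the integrand is integrable on `F` (★ p858040) and `∫_F = lim_K ∫_{𝔭^{−K}}` (`tendsto_setIntegral_of_monotone`), giving the dealer's (c) and, at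
conductor `𝒪` (`m = 0`), (d): `= μ(𝒪)(1 − q^{−2z})·Σ_{k=0}^{ord ξ} q^{k(1−2z)}`, `= μ(𝒪)(1 − q^{−2z})` for `‖ξ‖ = 1` (the Euler factor of `1∕ζ(2z)` at almost every place), `= 0`
for `‖ξ‖ > 1`.

* §1 `setIntegral_primePowBall_neg_addChar` (`J_k`), `integrableOn_weight_mul_addChar`, `setIntegral_outerShell_weight_mul_addChar` (one sphere),
  **`setIntegral_primePowBall_neg_weight_mul_addChar_eq_sum`** (the ball formula (a), all `z`).
* §2 **`setIntegral_primePowBall_neg_weight_mul_addChar_eq_closedForm`** (`K > n`: the closed form (c)), `…_eq_zero_of_not_mem` (`ξ ∉ 𝔭^m`), the ring identity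
  `one_add_sum_telescope_eq`.
* §3 `integrable_weight_mul_addChar` (`Re z > ½`), **`integral_weight_mul_addChar_eq_closedForm`** ∕ **`integral_weight_mul_addChar_eq_zero_of_not_mem`** (the whole-`F`
  integral), `norm_closedForm_le` (`≤ 2(n+1)μ(𝒪)` on `Re z ≥ ½`), `differentiable_closedForm` (entire).
* §4 (d) at conductor `𝒪`: `integral_weight_mul_addChar_eq_of_conductor_zero_of_normAbs_eq_one`, `integral_weight_mul_addChar_eq_zero_of_one_lt_normAbs`.
HONEST LABEL.  Count-neutral helper; proves no printed statement; HC_CM is proved only modulo the 7 printed citations (2 remaining named inputs: hLiu418 =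
`stmt-HodgeConjecture-24832`, h413 = `stmt-HodgeConjecture-24833`) until rung 0 closes.

## References
* [Tate1950] J. Tate, *Fourier analysis in number fields and Hecke's zeta-functions* (1950), §2.5 (the transforms `f̂_n` of `𝟙_{𝔭^n}`), in [CasselsFrohlichANT1967] Ch. XV.
* [Casselman1980] W. Casselman, *The unramified principal series of p-adic groups I*, Compositio Math. 40 (1980), §3.
-/

set_option autoImplicit false
set_option linter.dupNamespace false  -- the mandated namespace repeats the summit's segment (`HodgeConjecture.HodgeConjecture`)

noncomputable section

open MeasureTheory Filter Topology Set
open scoped NNReal ENNReal Classical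
open Literature.NumberTheory.GaloisRepresentations.IsNonarchimedeanLocalField
open Literature.NumberTheory.Automorphic Literature.NumberTheory.Automorphic.LocalFieldHaar
open Summit.HodgeConjecture.HodgeConjecture.Cruxes.HLiu418.K2LiuGKRankOneIntegral
open Summit.HodgeConjecture.HodgeConjecture.Cruxes.H413.K2E1IntertwiningLocalFactorU2

namespace Summit.HodgeConjecture.HodgeConjecture.Cruxes.H413.K2E1FiniteWhittakerPolynomial

variable {F : Type*} [Field F] [ValuativeRel F] [TopologicalSpace F] [IsNonarchimedeanLocalField F]

/-! ## §0 A ring identity and the indicator bookkeeping -/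

/-- The telescoping identity behind the closed form: `1 + Σ_{k<n} c^{k+1}(q^{k+1} − q^k) − c^{n+1} q^n = (1 − c)·Σ_{k ≤ n} (c q)^k` (any commutative ring).
[cite: Casselman1980, §3] -/
theorem one_add_sum_telescope_eq {R : Type*} [CommRing R] (c q : R) (n : ℕ) :
    1 + (∑ k ∈ Finset.range n, c ^ (k + 1) * (q ^ (k + 1) - q ^ k)) - c ^ (n + 1) * q ^ n =
      (1 - c) * ∑ k ∈ Finset.range (n + 1), (c * q) ^ k := by
  induction n with
  | zero => simp
  | succ n ih =>
    rw [Finset.sum_range_succ, Finset.sum_range_succ _ (n + 1), mul_add (1 - c), ← ih]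
    ring

variable [MeasurableSpace F] [BorelSpace F] (μ : Measure F) [μ.IsAddHaarMeasure]

/-! ## §1 Ball integrals: orthogonality, one sphere, the ball formula -/

/-- **`J_k`** (★ Tate orthogonality read on the ball `𝔭^{−k}`): for `ψ` of conductor exponent `m`, `∫_{𝔭^{−k}} ψ(tξ) dμ(t) = q^k μ(𝒪)` if `ξ ∈ 𝔭^{m+k}`, else `0`.
[cite: Tate1950, §2.5] -/
theorem setIntegral_primePowBall_neg_addChar {ψ : AddChar F Circle} {m : ℤ} (hm : ψ.HasConductorExp m) (ξ : F) (k : ℕ) :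
    ∫ t in primePowBall F (-(k : ℤ)), ((ψ (t * ξ) : Circle) : ℂ) ∂μ =
      if ξ ∈ primePowBall F (m + k) then (((residueFieldCard F : ℝ) ^ k * μ.real (primePowBall F 0) : ℝ) : ℂ) else 0 := by
  rw [setIntegral_primePowBall_addChar_mul μ hm (-(k : ℤ)) ξ, sub_neg_eq_add, measureReal_primePowBall μ (-(k : ℤ)), inv_zpow', neg_neg,
    zpow_natCast]

/-- The integrand `max(1,‖t‖)^{−2z}·ψ(tξ)` is integrable on every ball (continuous on a compact set). [folklore] -/
theorem integrableOn_weight_mul_addChar {ψ : AddChar F Circle} (hψ : Continuous ψ) (ξ : F) (z : ℂ) (j : ℤ) :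
    IntegrableOn (fun t : F => (((max 1 ((normAbs F t : ℝ≥0) : ℝ) : ℝ) : ℂ) ^ (-(2 * z))) * ((ψ (t * ξ) : Circle) : ℂ)) (primePowBall F j) μ := by
  haveI : T2Space F := (Literature.NumberTheory.GaloisRepresentations.IsNonarchimedeanLocalField.isLocalField F).toT2Space
  exact (((continuous_max_one_normAbs_cpow (2 * z)).mul
    (continuous_subtype_val.comp (hψ.comp (continuous_id.mul continuous_const)))).continuousOn.integrableOn_compact
    (isCompact_primePowBall j))

/-- `ψ(tξ)` alone is integrable on every ball. [folklore] -/
theorem integrableOn_addChar {ψ : AddChar F Circle} (hψ : Continuous ψ) (ξ : F) (j : ℤ) :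
    IntegrableOn (fun t : F => ((ψ (t * ξ) : Circle) : ℂ)) (primePowBall F j) μ := by
  haveI : T2Space F := (Literature.NumberTheory.GaloisRepresentations.IsNonarchimedeanLocalField.isLocalField F).toT2Space
  exact (continuous_subtype_val.comp (hψ.comp (continuous_id.mul continuous_const))).continuousOn.integrableOn_compact
    (isCompact_primePowBall j)

/-- **One sphere**: on `𝔭^{−(k+1)} ∖ 𝔭^{−k}` the weight is the constant `(q^{−2z})^{k+1}`, so
`∫_{𝔭^{−(k+1)}} w ψ = ∫_{𝔭^{−k}} w ψ + (q^{−2z})^{k+1}·(∫_{𝔭^{−(k+1)}} ψ − ∫_{𝔭^{−k}} ψ)`. [cite: Tate1950, §2.5] [cite: Casselman1980, §3] -/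
theorem setIntegral_primePowBall_neg_succ_weight_mul_addChar {ψ : AddChar F Circle} (hψ : Continuous ψ) (ξ : F) (z : ℂ) (k : ℕ) :
    ∫ t in primePowBall F (-((k : ℤ) + 1)), (((max 1 ((normAbs F t : ℝ≥0) : ℝ) : ℝ) : ℂ) ^ (-(2 * z))) * ((ψ (t * ξ) : Circle) : ℂ) ∂μ =
      (∫ t in primePowBall F (-(k : ℤ)), (((max 1 ((normAbs F t : ℝ≥0) : ℝ) : ℝ) : ℂ) ^ (-(2 * z))) * ((ψ (t * ξ) : Circle) : ℂ) ∂μ) +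
        ((residueFieldCard F : ℂ) ^ (-(2 * z))) ^ (k + 1) *
          ((∫ t in primePowBall F (-((k : ℤ) + 1)), ((ψ (t * ξ) : Circle) : ℂ) ∂μ) - ∫ t in primePowBall F (-(k : ℤ)), ((ψ (t * ξ) : Circle) : ℂ) ∂μ) := by
  have hidx : (-((k : ℤ) + 1) + 1) = -(k : ℤ) := by ring
  have hsub : primePowBall F (-(k : ℤ)) ⊆ primePowBall F (-((k : ℤ) + 1)) := primePowBall_antitone (by omega)
  -- split the big ball into the small ball and the sphere
  have hsplit : ∀ (g : F → ℂ), IntegrableOn g (primePowBall F (-((k : ℤ) + 1))) μ →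
      ∫ t in primePowBall F (-((k : ℤ) + 1)), g t ∂μ =
        (∫ t in primePowBall F (-(k : ℤ)), g t ∂μ) + ∫ t in primePowBall F (-((k : ℤ) + 1)) \ primePowBall F (-(k : ℤ)), g t ∂μ := by
    intro g hg
    rw [setIntegral_sdiff (measurableSet_primePowBall _) hg hsub]
    ring
  rw [hsplit _ (integrableOn_weight_mul_addChar μ hψ ξ z _)]
  congr 1
  -- on the sphere the weight is constant
  have hconst : ∀ t ∈ primePowBall F (-((k : ℤ) + 1)) \ primePowBall F (-(k : ℤ)),
      (((max 1 ((normAbs F t : ℝ≥0) : ℝ) : ℝ) : ℂ) ^ (-(2 * z))) * ((ψ (t * ξ) : Circle) : ℂ) =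
        ((residueFieldCard F : ℂ) ^ (-(2 * z))) ^ (k + 1) * ((ψ (t * ξ) : Circle) : ℂ) := by
    intro t ht
    have ht' : t ∈ primePowBall F (-((k : ℤ) + 1)) \ primePowBall F (-((k : ℤ) + 1) + 1) := by rwa [hidx]
    have hq1 : (1 : ℝ) ≤ (residueFieldCard F : ℝ) ^ (k + 1) := one_le_pow₀ one_lt_residueFieldCard_real.le
    rw [coe_normAbs_of_mem_outerShell ht', max_eq_right hq1, ofReal_pow_cpow]
  rw [setIntegral_congr_fun ((measurableSet_primePowBall _).diff (measurableSet_primePowBall _)) hconst, integral_const_mul,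
    setIntegral_sdiff (measurableSet_primePowBall _) (integrableOn_addChar μ hψ ξ _) hsub]

/-- **THE BALL FORMULA (a), every `z`**: `∫_{𝔭^{−K}} max(1,‖t‖)^{−2z} ψ(tξ) dμ = J_0 + Σ_{k<K} (q^{−2z})^{k+1}·(J_{k+1} − J_k)` with `J_k = ∫_{𝔭^{−k}} ψ(tξ) dμ`.
[cite: Tate1950, §2.5] [cite: Casselman1980, §3] -/
theorem setIntegral_primePowBall_neg_weight_mul_addChar_eq_sum {ψ : AddChar F Circle} (hψ : Continuous ψ) (ξ : F) (z : ℂ) (K : ℕ) :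
    ∫ t in primePowBall F (-(K : ℤ)), (((max 1 ((normAbs F t : ℝ≥0) : ℝ) : ℝ) : ℂ) ^ (-(2 * z))) * ((ψ (t * ξ) : Circle) : ℂ) ∂μ =
      (∫ t in primePowBall F 0, ((ψ (t * ξ) : Circle) : ℂ) ∂μ) +
        ∑ k ∈ Finset.range K, ((residueFieldCard F : ℂ) ^ (-(2 * z))) ^ (k + 1) *
          ((∫ t in primePowBall F (-((k : ℤ) + 1)), ((ψ (t * ξ) : Circle) : ℂ) ∂μ) - ∫ t in primePowBall F (-(k : ℤ)), ((ψ (t * ξ) : Circle) : ℂ) ∂μ) := by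
  induction K with
  | zero =>
    rw [Finset.sum_range_zero, add_zero, Nat.cast_zero, neg_zero]
    refine setIntegral_congr_fun (measurableSet_primePowBall 0) fun t ht => ?_
    have h1 : ((normAbs F t : ℝ≥0) : ℝ) ≤ 1 := by
      rw [mem_primePowBall_iff, zpow_zero] at ht
      exact_mod_cast ht
    rw [max_eq_left h1, Complex.ofReal_one, Complex.one_cpow, one_mul]
  | succ K ih =>
    rw [Nat.cast_succ, setIntegral_primePowBall_neg_succ_weight_mul_addChar μ hψ ξ z K, ih, Finset.sum_range_succ]
    ring

/-! ## §2 The closed form on large balls -/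

/-- `J_k` when `ξ ∈ 𝔭^{m+n} ∖ 𝔭^{m+n+1}`: `J_k = q^k μ(𝒪)` for `k ≤ n` and `J_k = 0` for `n < k`. [cite: Tate1950, §2.5] -/
theorem setIntegral_primePowBall_neg_addChar_eq_ite {ψ : AddChar F Circle} {m : ℤ} (hm : ψ.HasConductorExp m) {ξ : F} {n : ℕ}
    (hn : ξ ∈ primePowBall F (m + n)) (hn' : ξ ∉ primePowBall F (m + n + 1)) (k : ℕ) :
    ∫ t in primePowBall F (-(k : ℤ)), ((ψ (t * ξ) : Circle) : ℂ) ∂μ =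
      if k ≤ n then (((residueFieldCard F : ℝ) ^ k * μ.real (primePowBall F 0) : ℝ) : ℂ) else 0 := by
  rw [setIntegral_primePowBall_neg_addChar μ hm ξ k]
  by_cases hk : k ≤ n
  · rw [if_pos (primePowBall_antitone (show m + (k : ℤ) ≤ m + (n : ℤ) by omega) hn : ξ ∈ primePowBall F (m + (k : ℤ))), if_pos hk]
  · rw [if_neg hk, if_neg (fun h : ξ ∈ primePowBall F (m + (k : ℤ)) => hn' (primePowBall_antitone (show m + (n : ℤ) + 1 ≤ m + (k : ℤ) by omega) h))]

/-- **THE CLOSED FORM (c) ON LARGE BALLS**: if `ξ ∈ 𝔭^{m+n} ∖ 𝔭^{m+n+1}` (`n = ord ξ − m ≥ 0`) then for every `K > n` and EVERY `z`,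
`∫_{𝔭^{−K}} max(1,‖t‖)^{−2z} ψ(tξ) dμ = μ(𝒪)·(1 − q^{−2z})·Σ_{k=0}^{n} (q^{−2z}·q)^k` — independent of `K`. [cite: Tate1950, §2.5] [cite: Casselman1980, §3] -/
theorem setIntegral_primePowBall_neg_weight_mul_addChar_eq_closedForm {ψ : AddChar F Circle} (hψ : Continuous ψ) {m : ℤ} (hm : ψ.HasConductorExp m)
    {ξ : F} {n : ℕ} (hn : ξ ∈ primePowBall F (m + n)) (hn' : ξ ∉ primePowBall F (m + n + 1)) (z : ℂ) {K : ℕ} (hK : n < K) :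
    ∫ t in primePowBall F (-(K : ℤ)), (((max 1 ((normAbs F t : ℝ≥0) : ℝ) : ℝ) : ℂ) ^ (-(2 * z))) * ((ψ (t * ξ) : Circle) : ℂ) ∂μ =
      (μ.real (primePowBall F 0) : ℂ) * ((1 - (residueFieldCard F : ℂ) ^ (-(2 * z))) *
        ∑ k ∈ Finset.range (n + 1), ((residueFieldCard F : ℂ) ^ (-(2 * z)) * (residueFieldCard F : ℂ)) ^ k) := by
  have hJ := setIntegral_primePowBall_neg_addChar_eq_ite μ hm hn hn'
  -- the terms of the ball formula vanish beyond `n`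
  have hterm0 : ∀ k, n < k →
      ((residueFieldCard F : ℂ) ^ (-(2 * z))) ^ (k + 1) * ((∫ t in primePowBall F (-((k : ℤ) + 1)), ((ψ (t * ξ) : Circle) : ℂ) ∂μ) - ∫ t in primePowBall F (-(k : ℤ)), ((ψ (t * ξ) : Circle) : ℂ) ∂μ) = 0 := by
    intro k hk
    have h1 := hJ (k + 1)
    rw [Nat.cast_succ] at h1
    rw [h1, hJ k, if_neg (by omega), if_neg (by omega), sub_zero, mul_zero]
  have hstab : ∀ j : ℕ, ∑ k ∈ Finset.range (n + 1 + j), ((residueFieldCard F : ℂ) ^ (-(2 * z))) ^ (k + 1) *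
      ((∫ t in primePowBall F (-((k : ℤ) + 1)), ((ψ (t * ξ) : Circle) : ℂ) ∂μ) - ∫ t in primePowBall F (-(k : ℤ)), ((ψ (t * ξ) : Circle) : ℂ) ∂μ) =
      ∑ k ∈ Finset.range (n + 1), ((residueFieldCard F : ℂ) ^ (-(2 * z))) ^ (k + 1) *
        ((∫ t in primePowBall F (-((k : ℤ) + 1)), ((ψ (t * ξ) : Circle) : ℂ) ∂μ) - ∫ t in primePowBall F (-(k : ℤ)), ((ψ (t * ξ) : Circle) : ℂ) ∂μ) := by
    intro j
    induction j with
    | zero => rw [add_zero]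
    | succ j ih => rw [← add_assoc, Finset.sum_range_succ, ih, hterm0 _ (by omega), add_zero]
  obtain ⟨j, rfl⟩ : ∃ j, K = n + 1 + j := ⟨K - (n + 1), by omega⟩
  rw [setIntegral_primePowBall_neg_weight_mul_addChar_eq_sum μ hψ ξ z, hstab j, Finset.sum_range_succ]
  -- evaluate `J_0`, the terms `k < n`, and the term `k = n`
  have hJ0 : ∫ t in primePowBall F 0, ((ψ (t * ξ) : Circle) : ℂ) ∂μ = (μ.real (primePowBall F 0) : ℂ) := by
    have h := hJ 0
    rw [Nat.cast_zero, neg_zero] at h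
    rw [h, if_pos (Nat.zero_le n), pow_zero, one_mul]
  have hmid : ∑ k ∈ Finset.range n, ((residueFieldCard F : ℂ) ^ (-(2 * z))) ^ (k + 1) *
      ((∫ t in primePowBall F (-((k : ℤ) + 1)), ((ψ (t * ξ) : Circle) : ℂ) ∂μ) - ∫ t in primePowBall F (-(k : ℤ)), ((ψ (t * ξ) : Circle) : ℂ) ∂μ) =
      (μ.real (primePowBall F 0) : ℂ) * ∑ k ∈ Finset.range n, ((residueFieldCard F : ℂ) ^ (-(2 * z))) ^ (k + 1) * ((residueFieldCard F : ℂ) ^ (k + 1) - (residueFieldCard F : ℂ) ^ k) := by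
    rw [Finset.mul_sum]
    refine Finset.sum_congr rfl fun k hk => ?_
    have hk' : k < n := Finset.mem_range.1 hk
    have h1 := hJ (k + 1)
    rw [Nat.cast_succ] at h1
    rw [h1, hJ k, if_pos (by omega), if_pos hk'.le]
    push_cast
    ring
  have hlast : ((residueFieldCard F : ℂ) ^ (-(2 * z))) ^ (n + 1) * ((∫ t in primePowBall F (-((n : ℤ) + 1)), ((ψ (t * ξ) : Circle) : ℂ) ∂μ) - ∫ t in primePowBall F (-(n : ℤ)), ((ψ (t * ξ) : Circle) : ℂ) ∂μ) =
      -((μ.real (primePowBall F 0) : ℂ) * (((residueFieldCard F : ℂ) ^ (-(2 * z))) ^ (n + 1) * (residueFieldCard F : ℂ) ^ n)) := by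
    have h1 := hJ (n + 1)
    rw [Nat.cast_succ] at h1
    rw [h1, hJ n, if_neg (by omega), if_pos le_rfl, zero_sub]
    push_cast
    ring
  rw [hJ0, hmid, hlast, ← one_add_sum_telescope_eq ((residueFieldCard F : ℂ) ^ (-(2 * z))) (residueFieldCard F : ℂ) n]
  ring

/-- **VANISHING when `ξ ∉ 𝔭^m`** (`ord ξ < m`, "`n < 0`"): every `J_k = 0`, so `∫_{𝔭^{−K}} max(1,‖t‖)^{−2z} ψ(tξ) dμ = 0` for every `K` and every `z`. [cite: Tate1950, §2.5] -/
theorem setIntegral_primePowBall_neg_weight_mul_addChar_eq_zero_of_not_mem {ψ : AddChar F Circle} (hψ : Continuous ψ) {m : ℤ} (hm : ψ.HasConductorExp m)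
    {ξ : F} (hξ : ξ ∉ primePowBall F m) (z : ℂ) (K : ℕ) :
    ∫ t in primePowBall F (-(K : ℤ)), (((max 1 ((normAbs F t : ℝ≥0) : ℝ) : ℝ) : ℂ) ^ (-(2 * z))) * ((ψ (t * ξ) : Circle) : ℂ) ∂μ = 0 := by
  have hJ : ∀ k : ℕ, ∫ t in primePowBall F (-(k : ℤ)), ((ψ (t * ξ) : Circle) : ℂ) ∂μ = 0 := fun k => by
    rw [setIntegral_primePowBall_neg_addChar μ hm ξ k,
      if_neg (fun h : ξ ∈ primePowBall F (m + (k : ℤ)) => hξ (primePowBall_antitone (show m ≤ m + (k : ℤ) by omega) h))]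
  rw [setIntegral_primePowBall_neg_weight_mul_addChar_eq_sum μ hψ ξ z K]
  have h0 := hJ 0
  rw [Nat.cast_zero, neg_zero] at h0
  rw [h0, zero_add]
  refine Finset.sum_eq_zero fun k _ => ?_
  have h1 := hJ (k + 1)
  rw [Nat.cast_succ] at h1
  rw [h1, hJ k, sub_zero, mul_zero]

/-! ## §3 The whole-`F` integral for `Re z > ½`; the polynomial is entire and bounded on `Re z ≥ ½` -/

omit [MeasurableSpace F] [BorelSpace F] in
/-- `⋃_K 𝔭^{−K} = F`. [folklore] -/
theorem iUnion_primePowBall_neg_nat : (⋃ K : ℕ, primePowBall F (-(K : ℤ))) = Set.univ := by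
  refine Set.eq_univ_of_forall fun t => Set.mem_iUnion.2 ?_
  obtain ⟨K, hK⟩ := pow_unbounded_of_one_lt ((normAbs F t : ℝ≥0) : ℝ) (one_lt_residueFieldCard_real (F := F))
  refine ⟨K, ?_⟩
  rw [mem_primePowBall_iff, inv_zpow', neg_neg, zpow_natCast]
  exact_mod_cast hK.le

/-- For `Re z > ½` the integrand `max(1,‖t‖)^{−2z} ψ(tξ)` is integrable on `F` (★ p858040 for the weight, `‖ψ‖ = 1`). [cite: Casselman1980, §3] -/
theorem integrable_weight_mul_addChar {ψ : AddChar F Circle} (hψ : Continuous ψ) (ξ : F) {z : ℂ} (hz : 1 / 2 < z.re) :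
    Integrable (fun t : F => (((max 1 ((normAbs F t : ℝ≥0) : ℝ) : ℝ) : ℂ) ^ (-(2 * z))) * ((ψ (t * ξ) : Circle) : ℂ)) μ :=
  (integrable_and_integral_max_one_normAbs_cpow_two_mul μ hz).1.mul_bdd
    (continuous_subtype_val.comp (hψ.comp (continuous_id.mul continuous_const))).aestronglyMeasurable
    (Eventually.of_forall fun _ => (Circle.norm_coe _).le)

/-- The whole-`F` integral is the limit of the ball integrals (`Re z > ½`). [folklore] -/
theorem tendsto_setIntegral_primePowBall_neg_weight_mul_addChar {ψ : AddChar F Circle} (hψ : Continuous ψ) (ξ : F) {z : ℂ} (hz : 1 / 2 < z.re) :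
    Tendsto (fun K : ℕ => ∫ t in primePowBall F (-(K : ℤ)), (((max 1 ((normAbs F t : ℝ≥0) : ℝ) : ℝ) : ℂ) ^ (-(2 * z))) * ((ψ (t * ξ) : Circle) : ℂ) ∂μ)
      atTop (𝓝 (∫ t, (((max 1 ((normAbs F t : ℝ≥0) : ℝ) : ℝ) : ℂ) ^ (-(2 * z))) * ((ψ (t * ξ) : Circle) : ℂ) ∂μ)) := by
  have hmono : Monotone fun K : ℕ => primePowBall F (-(K : ℤ)) := fun a b hab => primePowBall_antitone (by omega)
  have h := tendsto_setIntegral_of_monotone (μ := μ)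
    (f := fun t : F => (((max 1 ((normAbs F t : ℝ≥0) : ℝ) : ℝ) : ℂ) ^ (-(2 * z))) * ((ψ (t * ξ) : Circle) : ℂ))
    (fun K : ℕ => measurableSet_primePowBall (-(K : ℤ))) hmono
    (by rw [iUnion_primePowBall_neg_nat]; exact (integrable_weight_mul_addChar μ hψ ξ hz).integrableOn)
  rwa [iUnion_primePowBall_neg_nat, setIntegral_univ] at h

/-- **W2-fin (c): THE FINITE WHITTAKER INTEGRAL IS A POLYNOMIAL IN `q^{−z}`** — for `ψ` continuous of conductor exponent `m`, `ξ ∈ 𝔭^{m+n} ∖ 𝔭^{m+n+1}` and `Re z > ½`: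
`∫_F max(1,‖t‖)^{−2z} ψ(tξ) dμ(t) = μ(𝒪)·(1 − q^{−2z})·Σ_{k=0}^{n} (q^{−2z}·q)^k`. [cite: Tate1950, §2.5] [cite: Casselman1980, §3] -/
theorem integral_weight_mul_addChar_eq_closedForm {ψ : AddChar F Circle} (hψ : Continuous ψ) {m : ℤ} (hm : ψ.HasConductorExp m)
    {ξ : F} {n : ℕ} (hn : ξ ∈ primePowBall F (m + n)) (hn' : ξ ∉ primePowBall F (m + n + 1)) {z : ℂ} (hz : 1 / 2 < z.re) :
    ∫ t, (((max 1 ((normAbs F t : ℝ≥0) : ℝ) : ℝ) : ℂ) ^ (-(2 * z))) * ((ψ (t * ξ) : Circle) : ℂ) ∂μ =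
      (μ.real (primePowBall F 0) : ℂ) * ((1 - (residueFieldCard F : ℂ) ^ (-(2 * z))) *
        ∑ k ∈ Finset.range (n + 1), ((residueFieldCard F : ℂ) ^ (-(2 * z)) * (residueFieldCard F : ℂ)) ^ k) := by
  refine tendsto_nhds_unique (tendsto_setIntegral_primePowBall_neg_weight_mul_addChar μ hψ ξ hz) ?_
  refine tendsto_const_nhds.congr' ?_
  filter_upwards [Filter.eventually_gt_atTop n] with K hK
  exact (setIntegral_primePowBall_neg_weight_mul_addChar_eq_closedForm μ hψ hm hn hn' z hK).symm

/-- **W2-fin (c), vanishing branch**: if `ξ ∉ 𝔭^m` then `∫_F max(1,‖t‖)^{−2z} ψ(tξ) dμ(t) = 0` (`Re z > ½`). [cite: Tate1950, §2.5] -/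
theorem integral_weight_mul_addChar_eq_zero_of_not_mem {ψ : AddChar F Circle} (hψ : Continuous ψ) {m : ℤ} (hm : ψ.HasConductorExp m)
    {ξ : F} (hξ : ξ ∉ primePowBall F m) {z : ℂ} (hz : 1 / 2 < z.re) :
    ∫ t, (((max 1 ((normAbs F t : ℝ≥0) : ℝ) : ℝ) : ℂ) ^ (-(2 * z))) * ((ψ (t * ξ) : Circle) : ℂ) ∂μ = 0 := by
  refine tendsto_nhds_unique (tendsto_setIntegral_primePowBall_neg_weight_mul_addChar μ hψ ξ hz) ?_
  exact tendsto_const_nhds.congr' (Eventually.of_forall fun K =>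
    (setIntegral_primePowBall_neg_weight_mul_addChar_eq_zero_of_not_mem μ hψ hm hξ z K).symm)

omit [MeasurableSpace F] [BorelSpace F] in
/-- **The closed form is ENTIRE in `z`** (a polynomial in `q^{−z}`). -/
theorem differentiable_closedForm (M : ℂ) (n : ℕ) :
    Differentiable ℂ fun z : ℂ => M * ((1 - (residueFieldCard F : ℂ) ^ (-(2 * z))) *
      ∑ k ∈ Finset.range (n + 1), ((residueFieldCard F : ℂ) ^ (-(2 * z)) * (residueFieldCard F : ℂ)) ^ k) := by
  have hq : (residueFieldCard F : ℂ) ≠ 0 := Nat.cast_ne_zero.2 (residueFieldCard_ne_zero F)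
  have hc : Differentiable ℂ fun z : ℂ => (residueFieldCard F : ℂ) ^ (-(2 * z)) :=
    ((differentiable_id.const_mul (2 : ℂ)).neg).const_cpow (Or.inl hq)
  refine (differentiable_const M).mul (((differentiable_const 1).sub hc).mul ?_)
  exact Differentiable.fun_sum fun k _ => (hc.mul_const _).fun_pow k

omit [MeasurableSpace F] [BorelSpace F] in
/-- **The bound (c)**: on `Re z ≥ ½`, `‖μ(𝒪)(1 − q^{−2z})Σ_{k≤n}(q^{1−2z})^k‖ ≤ 2(n+1)·μ(𝒪)` (each `‖q^{k(1−2z)}‖ ≤ 1`, `‖1 − q^{−2z}‖ ≤ 2`). -/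
theorem norm_closedForm_le {M : ℝ} (hM : 0 ≤ M) (n : ℕ) {z : ℂ} (hz : 1 / 2 ≤ z.re) :
    ‖(M : ℂ) * ((1 - (residueFieldCard F : ℂ) ^ (-(2 * z))) *
      ∑ k ∈ Finset.range (n + 1), ((residueFieldCard F : ℂ) ^ (-(2 * z)) * (residueFieldCard F : ℂ)) ^ k)‖ ≤ 2 * (n + 1) * M := by
  have hq1 : (1 : ℝ) < residueFieldCard F := one_lt_residueFieldCard_real
  have hqpos : 0 < residueFieldCard F := Nat.pos_of_ne_zero (residueFieldCard_ne_zero F)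
  have hc : ‖(residueFieldCard F : ℂ) ^ (-(2 * z))‖ ≤ 1 := by
    rw [Complex.norm_natCast_cpow_of_pos hqpos]
    refine Real.rpow_le_one_of_one_le_of_nonpos hq1.le ?_
    simp only [Complex.neg_re, Complex.mul_re, Complex.re_ofNat, Complex.im_ofNat, zero_mul, sub_zero]
    linarith
  have hq0 : (0 : ℝ) < residueFieldCard F := one_pos.trans hq1
  have hcq : ‖(residueFieldCard F : ℂ) ^ (-(2 * z)) * (residueFieldCard F : ℂ)‖ ≤ 1 := by
    rw [norm_mul, Complex.norm_natCast, Complex.norm_natCast_cpow_of_pos hqpos, ← Real.rpow_add_one hq0.ne']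
    refine Real.rpow_le_one_of_one_le_of_nonpos hq1.le ?_
    simp only [Complex.neg_re, Complex.mul_re, Complex.re_ofNat, Complex.im_ofNat, zero_mul, sub_zero]
    linarith
  calc ‖(M : ℂ) * ((1 - (residueFieldCard F : ℂ) ^ (-(2 * z))) *
          ∑ k ∈ Finset.range (n + 1), ((residueFieldCard F : ℂ) ^ (-(2 * z)) * (residueFieldCard F : ℂ)) ^ k)‖
      = M * (‖1 - (residueFieldCard F : ℂ) ^ (-(2 * z))‖ *
          ‖∑ k ∈ Finset.range (n + 1), ((residueFieldCard F : ℂ) ^ (-(2 * z)) * (residueFieldCard F : ℂ)) ^ k‖) := by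
        rw [norm_mul, norm_mul, Complex.norm_real, Real.norm_of_nonneg hM]
    _ ≤ M * (2 * (n + 1)) := by
        refine mul_le_mul_of_nonneg_left ?_ hM
        refine mul_le_mul ?_ ?_ (norm_nonneg _) zero_le_two
        · exact (norm_sub_le _ _).trans (by rw [norm_one]; linarith)
        · refine (norm_sum_le _ _).trans ?_
          calc ∑ k ∈ Finset.range (n + 1), ‖((residueFieldCard F : ℂ) ^ (-(2 * z)) * (residueFieldCard F : ℂ)) ^ k‖
              ≤ ∑ _k ∈ Finset.range (n + 1), (1 : ℝ) := Finset.sum_le_sum fun k _ => by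
                  rw [norm_pow]; exact pow_le_one₀ (norm_nonneg _) hcq
            _ = n + 1 := by simp
    _ = 2 * (n + 1) * M := by ring

/-! ## §4 (d) Conductor `𝒪`: the unramified factor and the vanishing above `𝒪` -/

/-- **(d), `‖ξ‖ = 1`**: for `ψ` of conductor `𝒪` (`m = 0`) and a unit `ξ`, `∫_F max(1,‖t‖)^{−2z} ψ(tξ) dμ = μ(𝒪)·(1 − q^{−2z})` (`Re z > ½`) — the local Euler factor of
`1∕ζ_F(2z)` at almost every place. [cite: Casselman1980, §3] [cite: Tate1950, §2.5] -/
theorem integral_weight_mul_addChar_eq_of_conductor_zero_of_normAbs_eq_one {ψ : AddChar F Circle} (hψ : Continuous ψ) (h0 : ψ.HasConductorExp 0)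
    {ξ : F} (hξ : normAbs F ξ = 1) {z : ℂ} (hz : 1 / 2 < z.re) :
    ∫ t, (((max 1 ((normAbs F t : ℝ≥0) : ℝ) : ℝ) : ℂ) ^ (-(2 * z))) * ((ψ (t * ξ) : Circle) : ℂ) ∂μ =
      (μ.real (primePowBall F 0) : ℂ) * (1 - (residueFieldCard F : ℂ) ^ (-(2 * z))) := by
  have hn : ξ ∈ primePowBall F (0 + (0 : ℕ)) := by
    rw [mem_primePowBall_iff, hξ, Nat.cast_zero, add_zero, zpow_zero]
  have hn' : ξ ∉ primePowBall F (0 + (0 : ℕ) + 1) := by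
    rw [mem_primePowBall_iff, hξ, Nat.cast_zero, add_zero, zero_add, zpow_one, not_le]
    exact inv_residueFieldCard_lt_one
  rw [integral_weight_mul_addChar_eq_closedForm μ hψ h0 hn hn' hz, Finset.sum_range_one, pow_zero, mul_one]

/-- **(d), `‖ξ‖ > 1`**: for `ψ` of conductor `𝒪` and `ξ ∉ 𝒪`, `∫_F max(1,‖t‖)^{−2z} ψ(tξ) dμ = 0` (`Re z > ½`) — the Whittaker coefficient is supported on integral `ξ`.
[cite: Casselman1980, §3] [cite: Tate1950, §2.5] -/
theorem integral_weight_mul_addChar_eq_zero_of_one_lt_normAbs {ψ : AddChar F Circle} (hψ : Continuous ψ) (h0 : ψ.HasConductorExp 0)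
    {ξ : F} (hξ : 1 < normAbs F ξ) {z : ℂ} (hz : 1 / 2 < z.re) :
    ∫ t, (((max 1 ((normAbs F t : ℝ≥0) : ℝ) : ℝ) : ℂ) ^ (-(2 * z))) * ((ψ (t * ξ) : Circle) : ℂ) ∂μ = 0 := by
  refine integral_weight_mul_addChar_eq_zero_of_not_mem μ hψ h0 (fun h => ?_) hz
  rw [mem_primePowBall_iff, zpow_zero] at h
  exact not_lt.2 h hξ

end Summit.HodgeConjecture.HodgeConjecture.Cruxes.H413.K2E1FiniteWhittakerPolynomial

end
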